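import Summits.ABC.StewartYu.PadicShapeDepElimTwo
import HarnessLib

/-!
# Cell abc-stewartyu — draft route `YuMatveevShapeRat` (plan-m3 g2): the `2`-adic SHAPE bound for
# `ord₂(1 − ζ∏ξᵢ^{bᵢ})` (non-units, torsion, reduction to units `≡ 1 (mod 8)`), proved from the core

Cell `abc-stewartyu` (HOME `run/shared/lean/pub/abc-stewartyu/`; seat `lit-abc-yu2007` g3). Theorems only;
no definition, no named fact, nothing closed. Third `2`-adic ingredient of the draft item `PadicShapeChain`
(after `PadicShapeDepElimTwo.lean`): from the planner's text of the crux `PadicCoreTwoRat` (independent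
rationals `θᵢ ≡ 1 (mod 8)`) to the bound `ord₂(1 − Ξ) ≤ c'ʳ ∏Aᵢ (W + log 2A_max)` for `Ξ = ζ∏ξᵢ^{bᵢ} ≠ 1`,
`ζ = ±1`, NON-ZERO rationals `ξᵢ`, `h(ξᵢ) ≤ Aᵢ`, `1 ≤ Aᵢ ≤ A_max`, `1 ≤ A_max`, `log max(3,|bᵢ|) ≤ W`, `1 ≤ W`
(`padicShape_oneSub_of_indep_two`, `c' = 4 max(|c|, 20)`). Argument: if `ord₂(1 − Ξ) ≤ 0` the bound is
trivial; if `Ξ = −1` it is `1 ≤ c'ʳ ∏A (W + log 2A_max)`; otherwise `Ξ` is a `2`-adic unit, the `2`-free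
parts `uᵢ = ξᵢ 2^{−ord₂ ξᵢ}` are units with `h(uᵢ) ≤ h(ξᵢ)` and `∏ξᵢ^{bᵢ} = ∏uᵢ^{bᵢ}`, `θᵢ = uᵢ²` satisfies
`ord₂(θᵢ − 1) ≥ 3` unless `θᵢ = 1` (odd squares are `1 mod 8`), `Ξ² = ∏_{θᵢ ≠ 1} θᵢ^{bᵢ}`,
`ord₂(1 − Ξ) ≤ ord₂(Ξ² − 1)` (`padicValRat_add_one_le_sq_sub_one` for `−Ξ`), and the dependence-free bound
(`PadicShapeDepElim.dep_elim_two` on the index type `{i // θᵢ ≠ 1}`, heights `2Aᵢ`, `A_max ↦ 2A_max`)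
costs a factor `≤ 2 · 2ʳ`. This is the input of Evertse–Győry's §4.4.2 at the place `2` with `α = 1` before
`exists_small_exponents` / Case A–B (which remain, K-parametric). WHAT THIS IS NOT: no analytic estimate;
no crux moved; no abc claim. References: [EvertseGyory2015] §4.4 (pp. 80–81); [Yu1999] §1, §14.
-/

open Height Real Finset
open Literature.NumberTheory.DiophantineGeometry.Dioph
open Literature.Barriers.ABC

noncomputable section

namespace Summit.ABC.StewartYu

open PadicShapeDepElim in
/-- **`ord₂(1 − ζ∏ξᵢ^{bᵢ}) ≤ c'ʳ ∏Aᵢ (W + log 2A_max)` from the planner's `PadicCoreTwoRat` text**, for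
non-zero rationals `ξᵢ` (not necessarily units, not necessarily `≡ 1 (mod 8)`) and `ζ = ±1`;
`c' = 4 max(|c|, 20)`. [cite: EvertseGyory2015, §4.4 (pp. 80–81)] [cite: Yu1999, §14 (p. 377)] -/
theorem padicShape_oneSub_of_indep_two
    (h : ∃ c : ℝ, ∀ (r : ℕ) (θ : Fin r → ℚ) (m : Fin r → ℤ) (A : Fin r → ℝ) (Amax W : ℝ),
      (∀ i, 3 ≤ padicValRat 2 (θ i - 1)) →
      (∀ μ : Fin r → ℤ, ∏ i, θ i ^ μ i = 1 → μ = 0) →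
      (∀ i, Height.logHeight₁ (θ i) ≤ A i) → (∀ i, 1 ≤ A i) → (∀ i, A i ≤ Amax) →
      m ≠ 0 → (∀ i, Real.log (max 3 (|m i| : ℝ)) ≤ W) → 1 ≤ W →
      (padicValRat 2 (∏ i, θ i ^ m i - 1) : ℝ) ≤ c ^ r * (∏ i, A i) * (W + Real.log (2 * Amax))) :
    ∃ c : ℝ, ∀ (r : ℕ) (ξ : Fin r → ℚ) (b : Fin r → ℤ) (A : Fin r → ℝ) (Amax W : ℝ) (ζ : ℚ),
      (ζ = 1 ∨ ζ = -1) → (∀ i, ξ i ≠ 0) →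
      (∀ i, Height.logHeight₁ (ξ i) ≤ A i) → (∀ i, 1 ≤ A i) → (∀ i, A i ≤ Amax) → 1 ≤ Amax →
      (∀ i, Real.log (max 3 (|b i| : ℝ)) ≤ W) → 1 ≤ W → ζ * ∏ i, ξ i ^ b i ≠ 1 →
      (padicValRat 2 (1 - ζ * ∏ i, ξ i ^ b i) : ℝ) ≤ c ^ r * (∏ i, A i) * (W + Real.log (2 * Amax)) := by
  obtain ⟨c, hc⟩ := h
  set C := max |c| 20 with hCdef
  have hC : 20 ≤ C := le_max_right _ _
  refine ⟨4 * C, fun r ξ b A Amax W ζ hζ hξ hAh hA1 hAm hAmax hbW hW1 hΞ1 => ?_⟩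
  classical
  haveI : Fact (Nat.Prime 2) := ⟨Nat.prime_two⟩
  have hA0 : ∀ i, 0 < A i := fun i => lt_of_lt_of_le one_pos (hA1 i)
  have hP1 : 1 ≤ ∏ i, A i := by
    rw [← Finset.prod_const_one (s := (univ : Finset (Fin r)))]
    exact Finset.prod_le_prod (fun _ _ => zero_le_one) fun i _ => hA1 i
  have hL2A : 0 ≤ Real.log (2 * Amax) := Real.log_nonneg (by linarith)
  set G := W + Real.log (2 * Amax) with hG
  have hG1 : 1 ≤ G := by rw [hG]; linarith
  have h4C1 : (1 : ℝ) ≤ 4 * C := by linarith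
  have hRHS1 : 1 ≤ (4 * C) ^ r * (∏ i, A i) * G :=
    one_le_mul_of_one_le_of_one_le (one_le_mul_of_one_le_of_one_le (one_le_pow₀ h4C1) hP1) hG1
  set Ξ : ℚ := ζ * ∏ i, ξ i ^ b i with hΞ
  -- the trivial case `ord₂(1 − Ξ) ≤ 0`
  by_cases hv : padicValRat 2 (1 - Ξ) ≤ 0
  · have : (padicValRat 2 (1 - Ξ) : ℝ) ≤ 0 := by exact_mod_cast hv
    linarith
  have hv1 : 1 ≤ padicValRat 2 (1 - Ξ) := by push Not at hv; omega
  -- the case `Ξ = −1`: `ord₂ 2 = 1`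
  by_cases hΞm1 : Ξ = -1
  · have h2 : padicValRat 2 (1 - Ξ) = 1 := by
      rw [hΞm1, show (1 : ℚ) - -1 = ((2 : ℕ) : ℚ) by norm_num, padicValRat.of_nat]; simp
    rw [h2]; push_cast; linarith
  -- `Ξ` is a unit
  have hζ0 : ζ ≠ 0 := by rcases hζ with h | h <;> simp [h]
  have hζv : padicValRat 2 ζ = 0 := by
    rcases hζ with h | h
    · rw [h, padicValRat.one]
    · rw [h, padicValRat.neg, padicValRat.one]
  have hprod0 : ∏ i, ξ i ^ b i ≠ 0 := Finset.prod_ne_zero_iff.mpr fun i _ => zpow_ne_zero _ (hξ i)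
  have hΞ0 : Ξ ≠ 0 := mul_ne_zero hζ0 hprod0
  have hΞ1' : Ξ - 1 ≠ 0 := sub_ne_zero.mpr hΞ1
  have hvneg : padicValRat 2 (1 - Ξ) = padicValRat 2 (Ξ - 1) := by
    rw [show (1 : ℚ) - Ξ = -(Ξ - 1) by ring, padicValRat.neg]
  have hΞv : padicValRat 2 Ξ = 0 := by
    by_contra hne
    have := padicValRat_sub_one_nonpos_of_ne_zero hΞ0 hΞ1' hne
    rw [hvneg] at hv1; omega
  -- the `2`-free parts `uᵢ = ξᵢ 2^{−eᵢ}`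
  set e : Fin r → ℤ := fun i => padicValRat 2 (ξ i) with hedef
  set u : Fin r → ℚ := fun i => ξ i / (2 : ℚ) ^ e i with hudef
  have hp0 : (2 : ℚ) ≠ 0 := two_ne_zero
  have hu0 : ∀ i, u i ≠ 0 := fun i => div_ne_zero (hξ i) (zpow_ne_zero _ hp0)
  have huval : ∀ i, padicValRat 2 (u i) = 0 := by
    intro i
    simp only [hudef, hedef]
    rw [padicValRat.div (hξ i) (zpow_ne_zero _ hp0), padicValRat.zpow,
      show (2 : ℚ) = ((2 : ℕ) : ℚ) by norm_num, padicValRat.self one_lt_two, mul_one, sub_self]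
  have hfac : ∀ i, ξ i ^ b i = (2 : ℚ) ^ (e i * b i) * u i ^ b i := by
    intro i
    have hk : ξ i = (2 : ℚ) ^ e i * u i := by
      simp only [hudef]
      rw [mul_div_assoc', mul_div_cancel_left₀ _ (zpow_ne_zero _ hp0)]
    conv_lhs => rw [hk]
    rw [mul_zpow, ← zpow_mul]
  have hprodeq : ∏ i, ξ i ^ b i = (2 : ℚ) ^ (∑ i, e i * b i) * ∏ i, u i ^ b i := by
    rw [← rat_prod_zpow_eq_zpow_sum _ hp0, ← Finset.prod_mul_distrib]
    exact Finset.prod_congr rfl fun i _ => hfac i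
  have hU0 : ∏ i, u i ^ b i ≠ 0 := Finset.prod_ne_zero_iff.mpr fun i _ => zpow_ne_zero _ (hu0 i)
  have hvU : padicValRat 2 (∏ i, u i ^ b i) = 0 := by
    rw [padicValRat_finset_prod _ _ fun i _ => zpow_ne_zero _ (hu0 i)]
    exact Finset.sum_eq_zero fun i _ => by rw [padicValRat.zpow, huval i, mul_zero]
  have hS : ∑ i, e i * b i = 0 := by
    by_contra hS
    have hval : padicValRat 2 Ξ = ∑ i, e i * b i := by
      rw [hΞ, padicValRat.mul hζ0 hprod0, hζv, hprodeq, padicValRat.mul (zpow_ne_zero _ hp0) hU0,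
        padicValRat.zpow, show (2 : ℚ) = ((2 : ℕ) : ℚ) by norm_num, padicValRat.self one_lt_two, hvU,
        mul_one, add_zero, zero_add]
    exact hS (by rw [← hval, hΞv])
  have hprodu : ∏ i, ξ i ^ b i = ∏ i, u i ^ b i := by rw [hprodeq, hS, zpow_zero, one_mul]
  -- `θᵢ = uᵢ²`, `Ξ² = ∏ θᵢ^{bᵢ}`
  set θ : Fin r → ℚ := fun i => u i ^ 2 with hθ
  have hθ0 : ∀ i, θ i ≠ 0 := fun i => pow_ne_zero 2 (hu0 i)
  have hΞsq : Ξ ^ 2 = ∏ i, θ i ^ b i := by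
    have h1 : Ξ ^ 2 = (∏ i, u i ^ b i) ^ 2 := by
      rw [hΞ, hprodu, mul_pow]
      rcases hζ with h | h <;> simp [h]
    rw [h1, ← Finset.prod_pow]
    refine Finset.prod_congr rfl fun i _ => ?_
    simp only [hθ]
    rw [← zpow_natCast, ← zpow_natCast, ← zpow_mul, ← zpow_mul, mul_comm]
  -- odd squares are `1 mod 8`: `ord₂(θᵢ − 1) ≥ 3` unless `θᵢ = 1`
  have h8 : ∀ i, θ i ≠ 1 → 3 ≤ padicValRat 2 (θ i - 1) := by
    intro i hne
    have hu := hu0 i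
    have hv := huval i
    have h1 : u i ^ 2 - 1 ≠ 0 := sub_ne_zero.mpr hne
    -- numerator and denominator of `uᵢ` are odd
    have hnum : (u i).num ≠ 0 := Rat.num_ne_zero.mpr hu
    have hv' := hv
    rw [padicValRat_def] at hv'
    have hden : ¬ 2 ∣ (u i).den := by
      intro hden
      have h1 : padicValNat 2 (u i).den ≠ 0 := by
        rw [Ne, padicValNat.eq_zero_iff]; push Not
        exact ⟨by norm_num, (u i).den_ne_zero, hden⟩
      have h2 : padicValInt 2 (u i).num ≠ 0 := by omega
      have h3 : (2 : ℤ) ∣ (u i).num := by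
        by_contra h; exact h2 (padicValInt.eq_zero_of_not_dvd h)
      have h4 : 2 ∣ (u i).num.natAbs := Int.natAbs_dvd_natAbs.mpr h3
      have h5 : 2 ∣ Nat.gcd (u i).num.natAbs (u i).den := Nat.dvd_gcd h4 hden
      rw [Nat.Coprime.gcd_eq_one (u i).reduced] at h5
      exact absurd (Nat.le_of_dvd one_pos h5) (by norm_num)
    have hnum2 : ¬ (2 : ℤ) ∣ (u i).num := by
      have h1 : padicValNat 2 (u i).den = 0 := padicValNat.eq_zero_of_not_dvd hden
      have h2 : padicValInt 2 (u i).num = 0 := by omega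
      intro h
      rw [padicValInt.eq_zero_iff] at h2
      rcases h2 with h2 | h2 | h2
      · norm_num at h2
      · exact hnum h2
      · exact h2 (by exact_mod_cast h)
    have hnumodd : Odd (u i).num := by rwa [← Int.not_even_iff_odd, even_iff_two_dvd]
    have hdenodd : Odd ((u i).den : ℤ) := by
      rw [← Int.not_even_iff_odd, even_iff_two_dvd]; exact_mod_cast hden
    have h8' : (8 : ℤ) ∣ (u i).num ^ 2 - ((u i).den : ℤ) ^ 2 := by
      have e : (u i).num ^ 2 - ((u i).den : ℤ) ^ 2 = ((u i).num ^ 2 - 1) - (((u i).den : ℤ) ^ 2 - 1) := by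
        ring
      exact e ▸ dvd_sub (Int.eight_dvd_sq_sub_one_of_odd hnumodd) (Int.eight_dvd_sq_sub_one_of_odd hdenodd)
    have hden' : ((u i).den : ℚ) ≠ 0 := by exact_mod_cast (u i).den_ne_zero
    have hrepr : u i ^ 2 - 1 = (((u i).num ^ 2 - ((u i).den : ℤ) ^ 2 : ℤ) : ℚ) / ((u i).den : ℚ) ^ 2 := by
      push_cast
      rw [show ((u i).num : ℚ) = u i * (u i).den from (Rat.mul_den_eq_num (u i)).symm]
      field_simp
    have hN : ((u i).num ^ 2 - ((u i).den : ℤ) ^ 2 : ℤ) ≠ 0 := by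
      intro h0; apply h1; rw [hrepr, h0]; simp
    show 3 ≤ padicValRat 2 (u i ^ 2 - 1)
    rw [hrepr, padicValRat.div (by exact_mod_cast hN) (pow_ne_zero 2 hden'), padicValRat.pow,
      padicValRat.of_int, padicValRat.of_nat, padicValNat.eq_zero_of_not_dvd hden]
    have h3 : 3 ≤ padicValInt 2 ((u i).num ^ 2 - ((u i).den : ℤ) ^ 2) := by
      have h8'' : ((2 : ℕ) : ℤ) ^ 3 ∣ (u i).num ^ 2 - ((u i).den : ℤ) ^ 2 := by norm_num; exact h8'
      rcases (padicValInt_dvd_iff 3 _).mp h8'' with h | h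
      · exact absurd h hN
      · exact h
    push_cast
    omega
  -- `ord₂(1 − Ξ) ≤ ord₂(Ξ² − 1)`
  have hΞp1 : Ξ + 1 ≠ 0 := fun h0 => hΞm1 (eq_neg_of_add_eq_zero_left h0)
  have htrans : padicValRat 2 (1 - Ξ) ≤ padicValRat 2 (Ξ ^ 2 - 1) := by
    have hnv : padicValRat 2 (-Ξ) = 0 := by rw [padicValRat.neg, hΞv]
    have h1 : -Ξ - 1 ≠ 0 := by rw [show -Ξ - 1 = -(Ξ + 1) by ring, neg_ne_zero]; exact hΞp1
    have h2 : -Ξ + 1 ≠ 0 := by rw [show -Ξ + 1 = -(Ξ - 1) by ring, neg_ne_zero]; exact hΞ1'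
    have h3 := padicValRat_add_one_le_sq_sub_one hnv h1 h2
    rwa [show -Ξ + 1 = 1 - Ξ by ring, neg_sq] at h3
  have hΞsq1 : Ξ ^ 2 ≠ 1 := by
    intro h1
    exact mul_ne_zero hΞ1' hΞp1 (by rw [show (Ξ - 1) * (Ξ + 1) = Ξ ^ 2 - 1 by ring, h1]; ring)
  -- the index type of the non-trivial `θᵢ`, and the dependence-free bound there
  let κ := {i : Fin r // θ i ≠ 1}
  have hprodκ : ∏ k : κ, θ k.val ^ b k.val = ∏ i, θ i ^ b i := by
    rw [← Finset.prod_subtype (univ.filter fun i => θ i ≠ 1) (p := fun i => θ i ≠ 1) (by simp)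
      (fun i => θ i ^ b i)]
    exact Finset.prod_filter_of_ne fun i _ hi => by intro h0; apply hi; rw [h0, one_zpow]
  have hΞκ : ∏ k : κ, θ k.val ^ b k.val ≠ 1 := by rw [hprodκ, ← hΞsq]; exact hΞsq1
  have hhθ : ∀ k : κ, logHeight₁ (θ k.val) ≤ 2 * A k.val := by
    intro k
    simp only [hθ]
    rw [← zpow_natCast, logHeight₁_zpow]
    push_cast
    have := (logHeight₁_div_zpow_padicValRat_le Nat.prime_two (hξ k.val)).trans (hAh k.val)
    have h2 : logHeight₁ (u k.val) = logHeight₁ (ξ k.val / (2 : ℚ) ^ e k.val) := rfl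
    norm_num
    linarith [h2 ▸ this]
  have hdep := dep_elim_two (C := C) hC (core_fintype_two hc) (Fintype.card κ) κ rfl
    (fun k => θ k.val) (fun k => b k.val) (fun k => 2 * A k.val) (2 * Amax) W (fun k => h8 k.val k.2)
    hhθ (fun k => by linarith [hA1 k.val]) (fun k => by linarith [hAm k.val]) (fun k => hbW k.val) hW1 hΞκ
  rw [hprodκ, ← hΞsq] at hdep
  -- bookkeeping: `C^{#κ} ≤ C^r`, `∏_κ 2A ≤ 2^r ∏ A`, `W + log 4A_max ≤ 2G`, `2 · 2^r C^r ≤ (4C)^r`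
  have hC1 : (1 : ℝ) ≤ C := by linarith
  have hcardκ : Fintype.card κ ≤ r := (Fintype.card_subtype_le _).trans (by simp)
  have h1 : C ^ Fintype.card κ ≤ C ^ r := pow_le_pow_right₀ hC1 hcardκ
  have h2 : ∏ k : κ, (2 * A k.val) ≤ (2 : ℝ) ^ r * ∏ i, A i := by
    rw [← Finset.prod_subtype (univ.filter fun i => θ i ≠ 1) (p := fun i => θ i ≠ 1) (by simp)
      (fun i => 2 * A i)]
    have hsplit := Finset.prod_filter_mul_prod_filter_not univ (fun i => θ i ≠ 1) (fun i => 2 * A i)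
    have hge1 : 1 ≤ ∏ i ∈ univ.filter (fun i => ¬ θ i ≠ 1), 2 * A i := by
      rw [← Finset.prod_const_one (s := univ.filter (fun i => ¬ θ i ≠ 1))]
      exact Finset.prod_le_prod (fun _ _ => zero_le_one) fun i _ => by linarith [hA1 i]
    have hnn : 0 ≤ ∏ i ∈ univ.filter (fun i => θ i ≠ 1), 2 * A i :=
      Finset.prod_nonneg fun i _ => by linarith [hA1 i]
    calc ∏ i ∈ univ.filter (fun i => θ i ≠ 1), 2 * A i
        ≤ (∏ i ∈ univ.filter (fun i => θ i ≠ 1), 2 * A i) *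
            ∏ i ∈ univ.filter (fun i => ¬ θ i ≠ 1), 2 * A i := le_mul_of_one_le_right hnn hge1
      _ = ∏ i, (2 * A i) := hsplit
      _ = (2 : ℝ) ^ r * ∏ i, A i := by
          rw [Finset.prod_mul_distrib, Finset.prod_const, card_univ, Fintype.card_fin]
  have h3 : W + Real.log (2 * (2 * Amax)) ≤ 2 * G := by
    rw [show (2 : ℝ) * (2 * Amax) = 2 * (2 * Amax) by ring, Real.log_mul two_ne_zero (by linarith), hG]
    have : Real.log 2 ≤ 1 := by have := Real.log_two_lt_d9; linarith
    linarith
  have hr : r ≠ 0 := by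
    rintro rfl
    apply hΞsq1
    rw [hΞsq]; simp
  have h4 : 2 * ((2 : ℝ) ^ r * C ^ r) ≤ (4 * C) ^ r := by
    rw [mul_pow, show (4 : ℝ) = 2 * 2 by norm_num, mul_pow]
    have h5 : (2 : ℝ) ≤ 2 ^ r := by
      calc (2 : ℝ) = 2 ^ 1 := (pow_one _).symm
        _ ≤ 2 ^ r := pow_le_pow_right₀ one_le_two (Nat.one_le_iff_ne_zero.mpr hr)
    have h6 : 0 ≤ (2 : ℝ) ^ r * C ^ r := by positivity
    nlinarith
  have hP0 : 0 ≤ ∏ i, A i := by linarith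
  have h7 : (padicValRat 2 (1 - Ξ) : ℝ) ≤ (padicValRat 2 (Ξ ^ 2 - 1) : ℝ) := by exact_mod_cast htrans
  have h8b : C ^ Fintype.card κ * (∏ k : κ, (2 * A k.val)) * (W + Real.log (2 * (2 * Amax))) ≤
      C ^ r * ((2 : ℝ) ^ r * ∏ i, A i) * (2 * G) := by
    have hκ0 : 0 ≤ ∏ k : κ, (2 * A k.val) := Finset.prod_nonneg fun k _ => by linarith [hA1 k.val]
    have hW0 : 0 ≤ W + Real.log (2 * (2 * Amax)) := by
      have := Real.log_nonneg (show (1 : ℝ) ≤ 2 * (2 * Amax) by linarith); linarith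
    calc C ^ Fintype.card κ * (∏ k : κ, (2 * A k.val)) * (W + Real.log (2 * (2 * Amax)))
        ≤ C ^ r * ((2 : ℝ) ^ r * ∏ i, A i) * (W + Real.log (2 * (2 * Amax))) :=
          mul_le_mul_of_nonneg_right (mul_le_mul h1 h2 hκ0 (by positivity)) hW0
      _ ≤ C ^ r * ((2 : ℝ) ^ r * ∏ i, A i) * (2 * G) :=
          mul_le_mul_of_nonneg_left h3 (by positivity)
  have h9 : C ^ r * ((2 : ℝ) ^ r * ∏ i, A i) * (2 * G) ≤ (4 * C) ^ r * (∏ i, A i) * G := by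
    have := mul_le_mul_of_nonneg_right h4 (by positivity : (0 : ℝ) ≤ (∏ i, A i) * G)
    linarith [this]
  linarith [h7, hdep, h8b, h9]

end Summit.ABC.StewartYu

end
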